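import Mathlib
import Summits.Ventures.PercRepro2.V2SP
import Summits.Ventures.PercRepro2.HallOffFrame
import Summits.Ventures.PercRepro2.HallOffAxis
import Summits.Ventures.PercRepro2.Tail2DCount
import Summits.Ventures.PercRepro2.Tail2DThreePoint
import Summits.Ventures.PercRepro2.Tail2DP2Series
import Summits.Ventures.PercRepro2.Tail2DDisjointPaths
import Summits.Ventures.PercRepro2.Tail2DP2SeriesSP
import Summits.Ventures.PercRepro2.Tail2DAxisUnimodal
import Summits.Ventures.PercRepro2.Tail2DOffAxis31
import Summits.Ventures.PercRepro2.Tail2DRowOne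
import Summits.Ventures.PercRepro2.Tail2DStepRowZero
import Summits.Ventures.PercRepro2.Tail2DStepCert
import Summits.Ventures.PercRepro2.Tail2DOffAxisCert
import Summits.Ventures.PercRepro2.Tail2DStepFour
import Summits.Ventures.PercRepro2.Tail2DStepFive
import Summits.Ventures.PercRepro2.Tail2DOffAxisSix
import Summits.Ventures.PercRepro2.Tail2DOffAxisSeven
import Summits.Ventures.PercRepro2.Tail2DOffAxisEight
import Summits.Ventures.PercRepro2.Tail2DOffAxisNine
import Summits.Ventures.PercRepro2.Tail2DColTwoCert
import Summits.Ventures.PercRepro2.Tail2DColTwo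
import Summits.Ventures.PercRepro2.Tail2DColThreeCert
import Summits.Ventures.PercRepro2.Tail2DColThree
import Summits.Ventures.PercRepro2.Tail2DColFourCert
import Summits.Ventures.PercRepro2.Tail2DColFour

/-!
# The anti-diagonal unimodality `T(a,j) ≤ T(a−1,j+1)` for every level `a` and every `j ≤ 4`
(seat mine-b, cell pub-perc-repro2; MINE-B.md §38)

The rows `j = 0` (the axis family, `SP.hallFn_phi_axis_count`) and `j = 1` (`t_row1`) and the columns
`j = 2, 3, 4` (`t_col2`, `t_col3`, `t_col4`) of the off-axis family, packaged as one statement: on every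
series–parallel pattern, uniformly two-coloured, `a` edge-disjoint red paths together with `j`
edge-disjoint blue paths are rarer than `a−1` red paths together with `j+1` blue paths, whenever
`j ≤ 4` and `j + 2 ≤ a`.
-/

namespace Summit.Ventures.PercRepro2.Tail2D

open V2Closure

/-- **`T(a,j) ≤ T(a−1,j+1)` for every `a ≥ j + 2` and every `j ≤ 4`, on every pattern of the grammar** -/
theorem t_offaxis_rows_le_four (s : V2Closure.SP) (a j : ℕ) (hj : j ≤ 4) (ha : j + 2 ≤ a) :
    (Finset.univ.filter (fun y : s.Conf => a ≤ s.rLab y ∧ j ≤ s.bLab y)).card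
      ≤ (Finset.univ.filter (fun y : s.Conf => a - 1 ≤ s.rLab y ∧ j + 1 ≤ s.bLab y)).card := by
  rcases (by omega : j = 0 ∨ j = 1 ∨ j = 2 ∨ j = 3 ∨ j = 4) with rfl | rfl | rfl | rfl | rfl
  · exact (offaxis_iff s a 0 (by omega)).2 (SP.hallFn_phi_axis_count s a (by omega))
  · exact t_row1 s a (by omega)
  · exact t_col2 s a (by omega)
  · exact t_col3 s a (by omega)
  · exact t_col4 s a (by omega)

/-- the count form: `0 ≤ Σ phi a j` for every `j ≤ 4` and `a ≥ j + 2` -/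
theorem SP.sum_phi_nonneg_of_le_four (s : V2Closure.SP) (a j : ℕ) (hj : j ≤ 4) (ha : j + 2 ≤ a) :
    0 ≤ ∑ x, phi a j (s.rLab x) (s.bLab x) :=
  (offaxis_iff s a j (by omega)).1 (t_offaxis_rows_le_four s a j hj ha)

end Summit.Ventures.PercRepro2.Tail2D
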